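import Summits.QuantumFields.YangMills.Theorems.SandwichVariancePinchingFloorMollification
import Summits.QuantumFields.YangMills.Theorems.SandwichVariancePinchingFloorWhitening

/-!
# Route `SandwichVariancePinching` — crux `QuadraticVarianceFloor` (stmt-QuantumFields-28260) PROVED

`(1 − 2δ)·(2 tr(H₀⁻¹HH₀⁻¹H) + bᵀH₀⁻¹b) ≤ gE(q²) − gE(q)²` for every dimension `n`, every `H₀ ≻ 0`, symmetric
`H`, `b ∈ ℝⁿ`, and every CONTINUOUS potential `A` with the second-difference sandwich
`(1−δ)hᵀH₀h ≤ A(x+h) + A(x−h) − 2A(x) ≤ (1+δ)hᵀH₀h` and the centring `∫ x_i e^{−A} = 0`, for all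
`0 ≤ δ ≤ 1/2` — i.e. the crux BY NAME with `C = 2`, `δ₀ = 1/2`, constants independent of `n`.

Assembly of: `…FloorMollification.floorWhitened` (whitened frame, continuous `A`: affine-score integration
by parts for smooth potentials + mollification + recentring) and `…FloorWhitening.quadraticVarianceFloor_of_whitened`
(conjugation by `H₀^{1/2}`).  The argument is the planner's (ym-idea-3 g13, PROOF-PLANS §g13) affine-dual /
Cramér–Rao route; no Brascamp–Lieb, no Helffer–Sjöstrand, no optimal transport is used, so this half of
`LogConcaveChart.QuadraticCovarianceComparison` (stmt-QuantumFields-26240) no longer depends on the named fact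
`Caffarelli2000_sandwichBrenierMap`.

HONEST SCOPE.  Free-hands work of the LEAD seat of crux stmt-QuantumFields-22884 (cell ym-idea-1).  This closes
ONE crux (the floor, rank 3) of planner ym-idea-3's draft-by-design sub-line; the deciding crux
`QuadraticVarianceCeiling` (28259), hence `QuadraticCovarianceComparison` (26240), the `LogConcaveChart` thesis,
rung R2a (`BalabanLadder.NT`) and every summit statement remain OPEN; the Yang–Mills mass gap is NOT proved by
any of this.
-/

noncomputable section

namespace Summit.QuantumFields.YangMills.Theorems

open SandwichVariancePinching in
/-- **Crux `QuadraticVarianceFloor` (stmt-QuantumFields-28260)**, with `C = 2` and `δ₀ = 1/2`: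
dimension-free variance floor for quadratic-plus-linear observables of a Gibbs weight whose potential is
sandwiched between `(1 ± δ)`-multiples of a Gaussian in the second-difference sense. [folklore] -/
theorem sandwichVariancePinching_quadraticVarianceFloor_proof :
    Summit.QuantumFields.YangMills.Theses.SandwichVariancePinching.QuadraticVarianceFloor :=
  quadraticVarianceFloor_of_whitened ⟨2, 1 / 2, by norm_num, by norm_num, by norm_num,
    fun δ hδ hδ2 n H b A hH hA hsw hcent => floorWhitened (n := n) hδ (by linarith) H b hH hA hsw hcent⟩

end Summit.QuantumFields.YangMills.Theorems

end
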